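import Literature.NumberTheory.Automorphic.AdicCompletionLocalField
import Literature.NumberTheory.Automorphic.ScholzeTorsionGalois
import Literature.NumberTheory.Automorphic.HarrisLanTaylorThorneCor627
import Literature.NumberTheory.GaloisRepresentations.TwistedSumDecomposition
import Literature.NumberTheory.GaloisRepresentations.LocalGaloisGroup

/-!
# Sketch — crux-ideate `stmt-Langlands-10785` (`GaloisRepOfRegularAlgebraic`), ideator 2, round 1

First lemmas of the two idea cards (signatures only; `sorry` bodies are intentional — this file is
a type-check of the statements, not a proof):

* card `generic-gap-no-monodromy` : `monodromy_eq_zero_of_gap` (linear-algebra core) and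
  `isUnramifiedAt_of_unramifiedTraces_of_gap` (framed local form over tree declarations);
* card `weil-trace-separation` : `trace_eq_of_forall_trace_mul_pow_eq` (backward Cayley–Hamilton
  extrapolation to inertia) and the typed shape of the proposed named leaf
  `corollary627_weilTraces_unramifiedSplit` (HLTT Cor. 6.27 / Varma Prop. 8.1 read at EVERY split
  place where `π_v` is unramified, on all Frobenius-power elements of the decomposition group).
-/

open scoped MatrixGroups Matrix NumberField Polynomial
open NumberField IsDedekindDomain Field Polynomial
open Literature.NumberTheory.Automorphic Literature.NumberTheory.GaloisRepresentations

noncomputable section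

namespace Summit.Langlands.Langlands.Cruxes.GaloisRepOfRegularAlgebraic.Sketch

/-! ## Card A — generic gap kills monodromy -/

/-- **Card A, first lemma (linear-algebra core).** If `Φ N = q • N Φ` (the Weil–Deligne /
tame-inertia relation `Φ N Φ⁻¹ = q N` between a Frobenius lift and the logarithm of a generator of
tame inertia) and no two roots of the characteristic polynomial of `Φ` are in ratio `q`, then
`N = 0`: `N` maps the generalised `λ`-eigenspace of `Φ` into the generalised `qλ`-eigenspace,
which is zero. No nilpotency hypothesis is needed. -/
theorem monodromy_eq_zero_of_gap {k : Type*} [Field k] [IsAlgClosed k] {n : ℕ}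
    (Φ N : Matrix (Fin n) (Fin n) k) (q : k)
    (hrel : Φ * N = q • (N * Φ))
    (hgap : ∀ a ∈ Φ.charpoly.roots, ∀ b ∈ Φ.charpoly.roots, a ≠ q * b) :
    N = 0 := by
  sorry

/-- **Card A, framed local form (the statement the crux consumes).** `K` a number field, `v ∤ ℓ`,
`r : Γ_K → GL_n(ℚ̄_ℓ)` continuous. Hypothesis `hss` = "the restriction of `r` to the decomposition
group at `v` has UNRAMIFIED SEMISIMPLIFICATION with arithmetic-Frobenius eigenvalues `β`", in trace
form: every element acting as the `d`-th power of the arithmetic Frobenius on the residue field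
(`IsFrobPow σ d`, any `d : ℤ`, inertia = `d = 0`) has trace `∑ b^d`. Hypothesis `hgap` = the
generic gap `a ≠ q_v b`. Conclusion: `r` is unramified at `v` with the predicted characteristic
polynomial — i.e. exactly the clause of lang.S27 / `GaloisRepOfRegularAlgebraic` at `v`.
Proof route: image of inertia lies in a unipotent group (unramified semisimplification), is
compact hence pro-`ℓ`, kills wild inertia (pro-`p`, `p ≠ ℓ`), factors through `ℤ_ℓ(1)` on which
Frobenius acts by `q_v`; `monodromy_eq_zero_of_gap` with `N = log r(t)`. -/
theorem isUnramifiedAt_of_unramifiedTraces_of_gap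
    {K : Type} [Field K] [NumberField K] {ℓ : ℕ} [Fact ℓ.Prime] {n : ℕ}
    (v : HeightOneSpectrum (𝓞 K)) (hv : ((ℓ : ℕ) : 𝓞 K) ∉ v.asIdeal)
    (r : FramedGaloisRep K (PadicAlgCl ℓ) n)
    (β : Multiset (PadicAlgCl ℓ)) (hβ : Multiset.card β = n) (h0 : (0 : PadicAlgCl ℓ) ∉ β)
    (hss : ∀ (σ : absoluteGaloisGroup (v.adicCompletion K)) (d : ℤ), IsFrobPow σ d →
      (((r.toLocal v) σ : GL (Fin n) (PadicAlgCl ℓ)) : Matrix (Fin n) (Fin n) (PadicAlgCl ℓ)).trace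
        = (β.map fun b => b ^ d).sum)
    (hgap : ∀ a ∈ β, ∀ b ∈ β, a ≠ (v.residueCard : PadicAlgCl ℓ) * b) :
    r.IsUnramifiedAt v ∧ r.HasFrobCharpolyAt v ((β.map fun b => X - C b).prod) := by
  sorry

/-- The gap hypothesis in Satake language, as the crux meets it: for the arithmetic-Frobenius
polynomial `arithFrobPolyOfSatake ι q_v n α` (roots `ι⁻¹((q_v^{(n-1)/2} α_j)⁻¹)`), the gap
`a ≠ q_v b` between roots is the gap `α_i ≠ q_v α_j` between Satake parameters, which for a
cuspidal `π` follows from genericity of `π_v` / the Jacquet–Shalika bound `‖α_j‖ < q_v^{1/2}`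
(tree: `norm_satakeParameter_le_sqrt`, `Shalika1974_isGeneric_of_hasLocalComponentAt_holds`,
`JacquetShalika1981_norm_lt_sqrt_of_isGeneric`). Signature of the dictionary step only. -/
theorem gap_arithFrobPolyOfSatake_of_gap_satake {ℓ : ℕ} [Fact ℓ.Prime]
    (ι : PadicAlgCl ℓ ≃+* ℂ) (q n : ℕ) (hq : 0 < q) (α : Multiset ℂ) (hα0 : (0 : ℂ) ∉ α)
    (hgap : ∀ a ∈ α, ∀ b ∈ α, a ≠ (q : ℂ) * b) :
    ∀ a ∈ (arithFrobPolyOfSatake ι q n α).roots, ∀ b ∈ (arithFrobPolyOfSatake ι q n α).roots,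
      a ≠ (q : PadicAlgCl ℓ) * b := by
  sorry

/-! ## Card B — Weil-trace separation: inertia by backward Cayley–Hamilton, then HLTT 7.12 on
nonzero-degree elements -/

/-- **Card B, first lemma (extrapolation to inertia).** If `tr(A Φ^d) = tr(A' Ψ^d)` for all
`d ≥ 1` with `Φ`, `Ψ` invertible, then `tr A = tr A'`: the sequence
`u(d) = tr(A Φ^d) - tr(A' Ψ^d)` satisfies the linear recurrence given by
`χ = charpoly Φ · charpoly Ψ` (Cayley–Hamilton), whose constant coefficient `± det Φ det Ψ` is a
unit, so `u(0)` is determined by `u(1), …, u(deg χ)`, all zero. Applied with `A = r(τ)`, `τ`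
inertial, `Φ = r(φ)` a Frobenius lift, `A' = 1`, `Ψ = diag β`: traces on inertia follow from traces
on elements of nonzero Frobenius degree — the only elements HLTT Prop. 7.12 (`prop712Hausdorff`,
proved in tree) can see, since `ε_ℓ^{-2}` has infinite order exactly there. -/
theorem trace_eq_of_forall_trace_mul_pow_eq {k : Type*} [Field k] {n m : ℕ}
    (A Φ : Matrix (Fin n) (Fin n) k) (A' Ψ : Matrix (Fin m) (Fin m) k)
    (hΦ : IsUnit Φ.det) (hΨ : IsUnit Ψ.det)
    (h : ∀ d : ℕ, 1 ≤ d → (A * Φ ^ d).trace = (A' * Ψ ^ d).trace) :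
    A.trace = A'.trace := by
  sorry

/-- **Card B, the proposed named leaf (typed shape; NOT a fact of the tree yet).**
Harris–Lan–Taylor–Thorne Cor. 6.27 read at EVERY place `v ∤ p` of the CM field `K ⊇ F₀` that is
split over `K⁺` and at which `π_v` is unramified — no condition on `π` at the other places over the
same rational prime, none on the ramification of `K` — and on every element of the decomposition
group at `v` of Frobenius degree `d` (not only `d = 1`): the roots of the characteristic polynomial
of `R_N(σ)` are the `d`-th powers of the roots of `arithFrobPolyOfSatake ı q_v n α` together with an
`n`-element multiset `E σ` (depending on `σ`, `v`, `π`, `ı`, not on `N`) scaled by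
`(q_v⁻¹)^{2 N d}`. This is the unramified-`π_v` content of Varma's Prop. 8.1 (arXiv:1411.2520; the
`2n`-dimensional `R_p(Π)` satisfies `WD(R_p(Π)|_{G_{F_v}})^{ss} ≅ rec((Π_ℓ)_v ⊗ |det|^{(1-2n)/2})^{ss}`
at every `v ∤ p` split over `F⁺`), applied to `Π = Π(π, N)`; it has the same genus as the tree's
leaf `corollary627_splitOrUnramified` (Bernstein-centre elements at `v` interpolate exactly like
the spherical Hecke operators do). "Split over `K⁺`" is rendered as in
`Scholze2015_galoisRep_of_modPEigensystem`: no non-trivial `K⁺`-automorphism of `K` fixes `v`. -/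
def corollary627_weilTraces_unramifiedSplit : Prop :=
  ∀ {n : ℕ} {K : Type} [Field K] [NumberField K] (hcpt : isCompact_glFiniteIntegralLevel n K)
    (p : ℕ) [Fact p.Prime], 1 < n → IsCMField K →
    ∀ (F₀ : IntermediateField ℚ K), Module.finrank ℚ F₀ = 2 ∧ IsTotallyComplex F₀ →
    HasTwoPrimesOver F₀ p →
    ∀ (π : CuspidalAutomorphicRepData n K hcpt), π.1.IsRegularAlgebraic →
    ∀ (ι : PadicAlgCl p ≃+* ℂ),
    ∃ (N₀ : ℕ) (R : ℕ → FramedGaloisRep K (PadicAlgCl p) (2 * n)),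
      (∀ N, N₀ ≤ N → (R N).toGaloisRep.IsSemisimple) ∧
      ∀ v : HeightOneSpectrum (𝓞 K), ((p : ℕ) : 𝓞 K) ∉ v.asIdeal →
        (∀ τ : K ≃ₐ[maximalRealSubfield K] K, τ ≠ 1 → τ • v ≠ v) →
        ∀ α : Multiset ℂ, π.1.HasSatakeParamAt v α →
        ∃ E : absoluteGaloisGroup (v.adicCompletion K) → Multiset (PadicAlgCl p),
          (∀ σ, Multiset.card (E σ) = n ∧ (0 : PadicAlgCl p) ∉ E σ) ∧
          ∀ (σ : absoluteGaloisGroup (v.adicCompletion K)) (d : ℤ), IsFrobPow σ d →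
          ∀ N, N₀ ≤ N →
            (FramedRep.charpoly ((R N).toLocal v) σ).roots =
              ((arithFrobPolyOfSatake ι v.residueCard n α).roots.map fun b => b ^ d) +
                (E σ).map fun e => e * (((v.residueCard : PadicAlgCl p)⁻¹) ^ (2 * (N : ℤ) * d))

/-- **Card B, target shape (what the leaf + `prop712Hausdorff_holds` + the extrapolation lemma
deliver): Varma's Theorem 1 at an unramified split place, in the trace form `hss` of Card A.**
Signature only: `r` is any semisimple representation with HLTT's property (`IsCompatible`), `v ∤ ℓ`
split over `K⁺` with `π_v` unramified of Satake parameter `α`; conclusion: every element of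
Frobenius degree `d` of the decomposition group at `v` has trace `∑ b^d` over the roots `b` of
`arithFrobPolyOfSatake ι q_v n α`. Feeding this into `isUnramifiedAt_of_unramifiedTraces_of_gap`
gives lang.S27's clause at `v`; Sorensen patching (in tree) removes "split". -/
theorem unramifiedTraces_of_weilTraces_leaf
    (h627 : corollary627_weilTraces_unramifiedSplit)
    (h712 : HarrisLanTaylorThorne2016.prop712Hausdorff)
    {n : ℕ} {K : Type} [Field K] [NumberField K] (hcpt : isCompact_glFiniteIntegralLevel n K)
    (ℓ : ℕ) [Fact ℓ.Prime] (hn : 1 < n) (hK : IsCMField K)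
    (F₀ : IntermediateField ℚ K) (hF₀ : Module.finrank ℚ F₀ = 2 ∧ IsTotallyComplex F₀)
    (hsplit : HasTwoPrimesOver F₀ ℓ)
    (π : CuspidalAutomorphicRepData n K hcpt) (hπ : π.1.IsRegularAlgebraic)
    (ι : PadicAlgCl ℓ ≃+* ℂ) (r : FramedGaloisRep K (PadicAlgCl ℓ) n)
    (hr : r.toGaloisRep.IsSemisimple) (hcomp : HarrisLanTaylorThorne2016.IsCompatible π.1 ι r)
    (v : HeightOneSpectrum (𝓞 K)) (hv : ((ℓ : ℕ) : 𝓞 K) ∉ v.asIdeal)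
    (hvsplit : ∀ τ : K ≃ₐ[maximalRealSubfield K] K, τ ≠ 1 → τ • v ≠ v)
    (α : Multiset ℂ) (hα : π.1.HasSatakeParamAt v α) :
    ∀ (σ : absoluteGaloisGroup (v.adicCompletion K)) (d : ℤ), IsFrobPow σ d →
      (((r.toLocal v) σ : GL (Fin n) (PadicAlgCl ℓ)) : Matrix (Fin n) (Fin n) (PadicAlgCl ℓ)).trace
        = ((arithFrobPolyOfSatake ι v.residueCard n α).roots.map fun b => b ^ d).sum := by
  sorry

end Summit.Langlands.Langlands.Cruxes.GaloisRepOfRegularAlgebraic.Sketch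

end
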